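import Literature.AlgebraicGeometry.HodgeTheory.SymmetricA3BraidRelationAllParities
import Literature.AlgebraicGeometry.HodgeTheory.PicardLefschetzSymmetricA3OfUniform
import HarnessLib

/-!
# hN (non-commutation) and hBRAID (the `B₂` braid relation) as predicates; hB2 ⟸ hPL ∧ hN ∧ hBRAID

Family `hodge`, layer `Literature/AlgebraicGeometry/HodgeTheory`; written by the prover seat `hodge-nonav-19716-p2` (g9, cell
`hodge-nonav`) for crux K1-B `VeryGeneralSignCommutatorsInHg` (`Summits/HodgeConjecture/HodgeConjecture/Theses/SignSymmetricPowers.lean`,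
stmt-HodgeConjecture-19716; registry v19 = {hPL, hCDK, hA3}).  Two PREDICATES (same quantifier prefix as
`SymmetricA3MonodromyRelations`; no named fact) naming the two halves of hA3 found in `SymmetricA3BraidRelation(AllParities)`, so
that a registry can cite them:

* `SymmetricA3NonCommutation n d f₁ g₀ g₂ ψ εa` — hN: THE rational transports `T₁, T₂` along the two circles of the symmetric `A₃`
  unfolding do not commute (the vanishing cycle of the `σ`-fixed node meets the exchanged pair: the Milnor-lattice residue;
  AGZV II Thm. 2.15 at the `B₂` point of §5.2);
* `SymmetricA3BraidRelation n d f₁ g₀ g₂ ψ εa` — hBRAID: `(T₁T₂)² = (T₂T₁)²` (monodromy image of the relation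
  `γ₁γ₂γ₁γ₂ = γ₂γ₁γ₂γ₁` of the Artin group of type `B₂` = π₁ of the complement of the bifurcation curve, Brieskorn 1971);
* `symmetricA3MonodromyRelations_of_nonComm_of_braid` / `SymmetricA3MonodromyRelations.nonComm` / `.braid` — given the pair data,
  Relations ⟺ NonCommutation ∧ BraidRelation (`symmetricA3MonodromyRelations_iff_nonComm_and_braid'`);
* `symmetricA3Relations_inline_of_uniform_of_nonComm_of_braid`, `picardLefschetz_symmetricA3_of_uniform_of_nonComm_of_braid` —
  hA3 (inline registry form) and hB2 from hPL = `picardLefschetz_nodalForms_uniform` ∧ hN ∧ hBRAID (inline forms, radii shrunk).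

CONDITIONAL plumbing; nothing here proves hN, hBRAID or HC; rung F-H1 not moved.

References: [ArnoldGuseinzadeVarchenko2012] AGZV II, Part I §5.2, §2.9 Thm. 2.15; [Brieskorn1973] E. Brieskorn, Sém. Bourbaki 401;
[VoisinHodgeII2003] §3.1.2, §3.2.1 Thm. 3.16.
-/

noncomputable section

open CategoryTheory AlgebraicGeometry MvPolynomial
open Literature.AlgebraicTopology.SingularHomology
open Literature.AlgebraicGeometry.Motives Literature.AlgebraicGeometry.Motives.UniversalHypersurface

namespace Literature.AlgebraicGeometry.HodgeTheory

section HodgeTheory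

/-- **hN — non-commutation of the two local monodromies at a symmetric `A₃` point** (predicate; quantifier prefix of
`SymmetricA3MonodromyRelations`): for `0 < |a'| < εa`, the midpoint base point and the two circles of hB2, THE rational transports
satisfy `T₁T₂ ≠ T₂T₁`. [cite: ArnoldGuseinzadeVarchenko2012, Part I §5.2 (pp. 129–133) and §2.9 Thm. 2.15]
[cite: VoisinHodgeII2003, §3.1.2 and §3.2.1 Thm. 3.16] -/
def SymmetricA3NonCommutation (n d : ℕ) (f₁ g₀ g₂ : MvPolynomial (Fin (n + 2)) ℂ) (ψ : ℂ → ℂ) (εa : ℝ) : Prop :=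
  ∀ (hU : IsCohomologicallyLocallyTrivialOn (family ℂ n d) Set.univ)
    (a' : ℂ), ‖a'‖ < εa → a' ≠ 0 →
    ∀ (t₀ : ComplexPoints (base ℂ n d)),
      pointForm ℂ n d t₀ = f₁ + a' • g₂ + (ψ a' / 2) • g₀ →
      ∀ (γ₁ γ₂ : Path t₀ t₀),
        (∀ θ : unitInterval, pointForm ℂ n d (γ₁ θ) =
          f₁ + a' • g₂ + (ψ a' / 2 * Complex.exp (2 * Real.pi * Complex.I * ((θ : ℝ) : ℂ))) • g₀) →
        (∀ θ : unitInterval, pointForm ℂ n d (γ₂ θ) =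
          f₁ + a' • g₂ +
            (ψ a' - ψ a' / 2 * Complex.exp (2 * Real.pi * Complex.I * ((θ : ℝ) : ℂ))) • g₀) →
        ∀ (T₁ T₂ : bettiCohomology (fiberOver (family ℂ n d) t₀) n ≃ₗ[ℚ]
            bettiCohomology (fiberOver (family ℂ n d) t₀) n),
          IsRatTransport (family ℂ n d) n hU (loopClassUniv n d γ₁) T₁ →
          IsRatTransport (family ℂ n d) n hU (loopClassUniv n d γ₂) T₂ →
            T₁.trans T₂ ≠ T₂.trans T₁

/-- **hBRAID — the `B₂` braid relation of the two local monodromies at a symmetric `A₃` point** (predicate): for THE rational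
transports along the two circles, `(T₁T₂)² = (T₂T₁)²` — the image in monodromy of `γ₁γ₂γ₁γ₂ = γ₂γ₁γ₂γ₁`, the defining relation
of the Artin group of type `B₂`, which is the fundamental group of the complement of the bifurcation curve `b(b − ψ(a)) = 0` of
the boundary singularity `B₂`. [cite: Brieskorn1973, §1 (π₁ of the complement of the discriminant of a finite Coxeter group = Artin group)]
[cite: ArnoldGuseinzadeVarchenko2012, Part I §5.2 (bifurcation set of B₂)] -/
def SymmetricA3BraidRelation (n d : ℕ) (f₁ g₀ g₂ : MvPolynomial (Fin (n + 2)) ℂ) (ψ : ℂ → ℂ) (εa : ℝ) : Prop :=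
  ∀ (hU : IsCohomologicallyLocallyTrivialOn (family ℂ n d) Set.univ)
    (a' : ℂ), ‖a'‖ < εa → a' ≠ 0 →
    ∀ (t₀ : ComplexPoints (base ℂ n d)),
      pointForm ℂ n d t₀ = f₁ + a' • g₂ + (ψ a' / 2) • g₀ →
      ∀ (γ₁ γ₂ : Path t₀ t₀),
        (∀ θ : unitInterval, pointForm ℂ n d (γ₁ θ) =
          f₁ + a' • g₂ + (ψ a' / 2 * Complex.exp (2 * Real.pi * Complex.I * ((θ : ℝ) : ℂ))) • g₀) →
        (∀ θ : unitInterval, pointForm ℂ n d (γ₂ θ) =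
          f₁ + a' • g₂ +
            (ψ a' - ψ a' / 2 * Complex.exp (2 * Real.pi * Complex.I * ((θ : ℝ) : ℂ))) • g₀) →
        ∀ (T₁ T₂ : bettiCohomology (fiberOver (family ℂ n d) t₀) n ≃ₗ[ℚ]
            bettiCohomology (fiberOver (family ℂ n d) t₀) n),
          IsRatTransport (family ℂ n d) n hU (loopClassUniv n d γ₁) T₁ →
          IsRatTransport (family ℂ n d) n hU (loopClassUniv n d γ₂) T₂ →
            (T₁.trans T₂).trans (T₁.trans T₂) = (T₂.trans T₁).trans (T₂.trans T₁)

variable {n d : ℕ} {f₁ g₀ g₂ : MvPolynomial (Fin (n + 2)) ℂ} {ψ : ℂ → ℂ} {εa : ℝ}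

/-- Shrinking the radius of hN. [cite: ArnoldGuseinzadeVarchenko2012, Part I §5.2] -/
theorem SymmetricA3NonCommutation.mono (h : SymmetricA3NonCommutation n d f₁ g₀ g₂ ψ εa) {εa' : ℝ} (hle : εa' ≤ εa) :
    SymmetricA3NonCommutation n d f₁ g₀ g₂ ψ εa' :=
  fun hU a' ha ha0 => h hU a' (lt_of_lt_of_le ha hle) ha0

/-- Shrinking the radius of hBRAID. [cite: Brieskorn1973, §1] -/
theorem SymmetricA3BraidRelation.mono (h : SymmetricA3BraidRelation n d f₁ g₀ g₂ ψ εa) {εa' : ℝ} (hle : εa' ≤ εa) :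
    SymmetricA3BraidRelation n d f₁ g₀ g₂ ψ εa' :=
  fun hU a' ha ha0 => h hU a' (lt_of_lt_of_le ha hle) ha0

/-- **Relations ⟸ pair data ∧ hN ∧ hBRAID** (all `n`). [cite: ArnoldGuseinzadeVarchenko2012, Part I §5.2 and §2.9 Thm. 2.15]
[cite: Brieskorn1973, §1] -/
theorem symmetricA3MonodromyRelations_of_nonComm_of_braid (hn : 1 ≤ n) (hd : 1 ≤ d)
    (hP : SymmetricA3PicardLefschetzPair n d f₁ g₀ g₂ ψ εa) (hN : SymmetricA3NonCommutation n d f₁ g₀ g₂ ψ εa)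
    (hB : SymmetricA3BraidRelation n d f₁ g₀ g₂ ψ εa) : SymmetricA3MonodromyRelations n d f₁ g₀ g₂ ψ εa :=
  (symmetricA3MonodromyRelations_iff_nonComm_and_braid' hn hd hP).2
    fun hU a' ha ha0 t₀ ht₀ γ₁ γ₂ hγ₁ hγ₂ T₁ T₂ hT₁ hT₂ =>
      ⟨hN hU a' ha ha0 t₀ ht₀ γ₁ γ₂ hγ₁ hγ₂ T₁ T₂ hT₁ hT₂, hB hU a' ha ha0 t₀ ht₀ γ₁ γ₂ hγ₁ hγ₂ T₁ T₂ hT₁ hT₂⟩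

/-- Relations ⟹ hN (no pair data needed). [cite: ArnoldGuseinzadeVarchenko2012, Part I §5.2] -/
theorem SymmetricA3MonodromyRelations.nonComm (h : SymmetricA3MonodromyRelations n d f₁ g₀ g₂ ψ εa) :
    SymmetricA3NonCommutation n d f₁ g₀ g₂ ψ εa :=
  fun hU a' ha ha0 t₀ ht₀ γ₁ γ₂ hγ₁ hγ₂ T₁ T₂ hT₁ hT₂ => (h hU a' ha ha0 t₀ ht₀ γ₁ γ₂ hγ₁ hγ₂ T₁ T₂ hT₁ hT₂).1

/-- Relations ∧ pair data ⟹ hBRAID. [cite: Brieskorn1973, §1] [cite: ArnoldGuseinzadeVarchenko2012, Part I §2.9 Thm. 2.15] -/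
theorem SymmetricA3MonodromyRelations.braid (hn : 1 ≤ n) (hd : 1 ≤ d)
    (hP : SymmetricA3PicardLefschetzPair n d f₁ g₀ g₂ ψ εa) (h : SymmetricA3MonodromyRelations n d f₁ g₀ g₂ ψ εa) :
    SymmetricA3BraidRelation n d f₁ g₀ g₂ ψ εa :=
  fun hU a' ha ha0 t₀ ht₀ γ₁ γ₂ hγ₁ hγ₂ T₁ T₂ hT₁ hT₂ =>
    ((symmetricA3MonodromyRelations_iff_nonComm_and_braid' hn hd hP).1 h hU a' ha ha0 t₀ ht₀ γ₁ γ₂ hγ₁ hγ₂ T₁ T₂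
      hT₁ hT₂).2

/-! ### Assembly with the uniform nodal package (binders GUARDED by `1 ≤ n`, `1 ≤ d`, as the clauses of hB2 are) -/

/-- **hB2-PL (inline) ⟸ hPL-uniform ∧ hA3 guarded by `n, d ≥ 1`.**  The clauses of hB2 carry the guard `∀ (hn : 1 ≤ n)
(hd : 1 ≤ d)` inside; accordingly the `A₃` relations are only needed for `n, d ≥ 1` (for `n = 0` or `d = 0` the clauses are
vacuous).  This is the form in which the binder is implied by hB2-PL (`SymmetricA3PicardLefschetzClauses.relations hn hd`).
[cite: ArnoldGuseinzadeVarchenko2012, Part I §5.2 and §2.9 Thm. 2.15] [cite: VoisinHodgeII2003, §3.2.1 Thm. 3.16] -/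
theorem symmetricA3PicardLefschetzClauses_inline_of_uniform_of_relations_guarded (H : picardLefschetz_nodalForms_uniform)
    (hR : ∀ (n d : ℕ) (f₁ g₀ g₂ : MvPolynomial (Fin (n + 2)) ℂ) (j k : Fin (n + 2)) (a : Fin (n + 2) → ℂˣ),
      1 ≤ n → 1 ≤ d → f₁.IsHomogeneous d → g₀.IsHomogeneous d → g₂.IsHomogeneous d → IsSymmetricA3Datum f₁ g₀ g₂ j k a →
      ∀ (εa εb : ℝ) (ψ : ℂ → ℂ), IsSymmetricA3Bifurcation f₁ g₀ g₂ j a εa εb ψ →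
        ∃ εa' : ℝ, 0 < εa' ∧ εa' ≤ εa ∧ SymmetricA3MonodromyRelations n d f₁ g₀ g₂ ψ εa')
    (n d : ℕ) (f₁ g₀ g₂ : MvPolynomial (Fin (n + 2)) ℂ) (j k : Fin (n + 2)) (a : Fin (n + 2) → ℂˣ)
    (hf₁ : f₁.IsHomogeneous d) (hg₀ : g₀.IsHomogeneous d) (hg₂ : g₂.IsHomogeneous d)
    (hD : IsSymmetricA3Datum f₁ g₀ g₂ j k a) (εa εb : ℝ) (ψ : ℂ → ℂ)
    (hBif : IsSymmetricA3Bifurcation f₁ g₀ g₂ j a εa εb ψ) :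
    ∃ εa' : ℝ, 0 < εa' ∧ εa' ≤ εa ∧ SymmetricA3PicardLefschetzClauses n d f₁ g₀ g₂ ψ εa' := by
  by_cases hnd : 1 ≤ n ∧ 1 ≤ d
  · obtain ⟨ε₁, h₁, h₁le, hP₁⟩ := symmetricA3PicardLefschetzPair_of_uniform H hf₁ hg₀ hg₂ hD hBif
    obtain ⟨ε₂, h₂, h₂le, hR₂⟩ := hR n d f₁ g₀ g₂ j k a hnd.1 hnd.2 hf₁ hg₀ hg₂ hD εa εb ψ hBif
    exact ⟨min ε₁ ε₂, lt_min h₁ h₂, (min_le_left _ _).trans h₁le,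
      symmetricA3PicardLefschetzClauses_of_pair_of_relations (hP₁.mono (min_le_left _ _))
        (hR₂.mono (min_le_right _ _))⟩
  · -- `n = 0` or `d = 0`: the clauses are guarded by `1 ≤ n`, `1 ≤ d` and hence vacuous
    refine ⟨εa, hBif.1, le_rfl, fun hn hd => ?_⟩
    exact absurd ⟨hn, hd⟩ hnd

/-- **hB2 = `picardLefschetz_symmetricA3` ⟸ hPL-uniform ∧ hA3 (guarded).** [cite: ArnoldGuseinzadeVarchenko2012, Part I §5.2]
[cite: VoisinHodgeII2003, §3.2.1 Thm. 3.16] -/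
theorem picardLefschetz_symmetricA3_of_uniform_of_relations_guarded (H : picardLefschetz_nodalForms_uniform)
    (hR : ∀ (n d : ℕ) (f₁ g₀ g₂ : MvPolynomial (Fin (n + 2)) ℂ) (j k : Fin (n + 2)) (a : Fin (n + 2) → ℂˣ),
      1 ≤ n → 1 ≤ d → f₁.IsHomogeneous d → g₀.IsHomogeneous d → g₂.IsHomogeneous d → IsSymmetricA3Datum f₁ g₀ g₂ j k a →
      ∀ (εa εb : ℝ) (ψ : ℂ → ℂ), IsSymmetricA3Bifurcation f₁ g₀ g₂ j a εa εb ψ →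
        ∃ εa' : ℝ, 0 < εa' ∧ εa' ≤ εa ∧ SymmetricA3MonodromyRelations n d f₁ g₀ g₂ ψ εa') :
    picardLefschetz_symmetricA3 :=
  IsSymmetricA3Datum.picardLefschetz_symmetricA3_of_PL
    (symmetricA3PicardLefschetzClauses_inline_of_uniform_of_relations_guarded H hR)

/-- **hB2 ⟸ hPL-uniform ∧ hN ∧ hBRAID (guarded, inline forms).**  The pair data from hPL turn hN ∧ hBRAID into the `A₃`
relations (`symmetricA3MonodromyRelations_of_nonComm_of_braid`, radii shrunk), whence hB2.
[cite: ArnoldGuseinzadeVarchenko2012, Part I §5.2 and §2.9 Thm. 2.15] [cite: Brieskorn1973, §1] [cite: VoisinHodgeII2003, §3.2.1 Thm. 3.16] -/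
theorem picardLefschetz_symmetricA3_of_uniform_of_nonComm_of_braid (H : picardLefschetz_nodalForms_uniform)
    (hN : ∀ (n d : ℕ) (f₁ g₀ g₂ : MvPolynomial (Fin (n + 2)) ℂ) (j k : Fin (n + 2)) (a : Fin (n + 2) → ℂˣ),
      1 ≤ n → 1 ≤ d → f₁.IsHomogeneous d → g₀.IsHomogeneous d → g₂.IsHomogeneous d → IsSymmetricA3Datum f₁ g₀ g₂ j k a →
      ∀ (εa εb : ℝ) (ψ : ℂ → ℂ), IsSymmetricA3Bifurcation f₁ g₀ g₂ j a εa εb ψ →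
        ∃ εa' : ℝ, 0 < εa' ∧ εa' ≤ εa ∧ SymmetricA3NonCommutation n d f₁ g₀ g₂ ψ εa')
    (hB : ∀ (n d : ℕ) (f₁ g₀ g₂ : MvPolynomial (Fin (n + 2)) ℂ) (j k : Fin (n + 2)) (a : Fin (n + 2) → ℂˣ),
      1 ≤ n → 1 ≤ d → f₁.IsHomogeneous d → g₀.IsHomogeneous d → g₂.IsHomogeneous d → IsSymmetricA3Datum f₁ g₀ g₂ j k a →
      ∀ (εa εb : ℝ) (ψ : ℂ → ℂ), IsSymmetricA3Bifurcation f₁ g₀ g₂ j a εa εb ψ →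
        ∃ εa' : ℝ, 0 < εa' ∧ εa' ≤ εa ∧ SymmetricA3BraidRelation n d f₁ g₀ g₂ ψ εa') :
    picardLefschetz_symmetricA3 := by
  refine picardLefschetz_symmetricA3_of_uniform_of_relations_guarded H
    fun n d f₁ g₀ g₂ j k a hn hd hf₁ hg₀ hg₂ hD εa εb ψ hBif => ?_
  obtain ⟨ε₁, h₁, h₁le, hP₁⟩ := symmetricA3PicardLefschetzPair_of_uniform H hf₁ hg₀ hg₂ hD hBif
  obtain ⟨ε₂, h₂, h₂le, hN₂⟩ := hN n d f₁ g₀ g₂ j k a hn hd hf₁ hg₀ hg₂ hD εa εb ψ hBif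
  obtain ⟨ε₃, h₃, h₃le, hB₃⟩ := hB n d f₁ g₀ g₂ j k a hn hd hf₁ hg₀ hg₂ hD εa εb ψ hBif
  refine ⟨min ε₁ (min ε₂ ε₃), lt_min h₁ (lt_min h₂ h₃), (min_le_left _ _).trans h₁le,
    symmetricA3MonodromyRelations_of_nonComm_of_braid hn hd (hP₁.mono (min_le_left _ _))
      (hN₂.mono ((min_le_right _ _).trans (min_le_left _ _)))
      (hB₃.mono ((min_le_right _ _).trans (min_le_right _ _)))⟩

/-- Conversely hB2 implies hN and hBRAID inside its own bifurcation datum, for `n, d ≥ 1` (registry audit: the new binders are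
implied by the old one). [cite: ArnoldGuseinzadeVarchenko2012, Part I §5.2 and §2.9 Thm. 2.15] [cite: Brieskorn1973, §1] -/
theorem picardLefschetz_symmetricA3.exists_nonComm_braid (Hb : picardLefschetz_symmetricA3) (hn : 1 ≤ n) (hd : 1 ≤ d)
    {j k : Fin (n + 2)} {a : Fin (n + 2) → ℂˣ}
    (hf₁ : f₁.IsHomogeneous d) (hg₀ : g₀.IsHomogeneous d) (hg₂ : g₂.IsHomogeneous d)
    (hD : IsSymmetricA3Datum f₁ g₀ g₂ j k a) :
    ∃ (εa εb : ℝ) (ψ : ℂ → ℂ), IsSymmetricA3Bifurcation f₁ g₀ g₂ j a εa εb ψ ∧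
      SymmetricA3NonCommutation n d f₁ g₀ g₂ ψ εa ∧ SymmetricA3BraidRelation n d f₁ g₀ g₂ ψ εa := by
  obtain ⟨εa, εb, ψ, hB, hcl⟩ := Hb n d f₁ g₀ g₂ j k a hf₁ hg₀ hg₂ hD
  have hR := SymmetricA3PicardLefschetzClauses.relations hn hd hcl
  have hP := SymmetricA3PicardLefschetzClauses.pair hcl
  exact ⟨εa, εb, ψ, hB, hR.nonComm, hR.braid hn hd hP⟩

end HodgeTheory

end Literature.AlgebraicGeometry.HodgeTheory

end
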